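import Summits.NavierStokesRegularity.FluidComputer.PalasekTowerOvershootPressureRate

/-!
# REGISTER v2.3′: the PRESSURE SPEED LIMIT — the speed maximum of a classical flow grows at most at the
# rate of the velocity-projected force-minus-pressure-gradient at its running maxima

Cell `ns-blowup`, seat `ns-blowup-fc-prover-3` (g3; prover; D-0074 GROUP C/E «BRIDGE SUPPORT»;
bears_on LADDER-NS N1, route `PalasekTowerBreakdown`, child crux stmt-NavierStokesRegularity-19249
`HeredityAtOne` (upper stub `AprioriCeilingAt 1`) and -19250 `HeredityFromTwo` (`AprioriCeiling`) —
supports only, nothing claimed or closed). Corollary file of `PalasekTowerLineCrossing.lean` (p446722)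
and `PalasekTowerOvershootPressureRate.lean` (p446973). LABEL: E–C typing (KERNEL analysis; every
statement PROVED; no `Prop` introduced; no unproved fact). WHAT THIS IS NOT: not Navier–Stokes
evidence — nothing is constructed; no stub is proved or refuted; an a-priori INEQUALITY every
finite-energy classical Clay flow satisfies, and the upper stubs rephrased as a PRESSURE-GRADIENT
CEILING at running speed maxima (an OPEN hypothesis).

## What is proved

* `norm_le_of_pushRate` — THE SPEED LIMIT: for any finite-energy classical solution on `[0, T]` with
  Schwartz datum and Clay force (`ν > 0`), if `‖u‖ ≤ A` on `[0, T₁] × ℝ³` and at every later running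
  global speed maximum above `A` (exceeding all earlier speeds) the push obeys
  `⟪u, f⟫ − ⟪u, ∇p⟫ ≤ K‖u‖` (`K ≥ 0`), then `‖u(t, x)‖ ≤ A + K (t − T₁)` on `[T₁, T] × ℝ³`. Viscosity
  never raises the maximum (`⟪u, Δu⟫ ≤ −|Du|²_F ≤ 0` there); only the projected force and pressure
  gradient do, and at most at their own rate. Contrapositive of the line crossing with any slope in
  `(K, mean rate)`.
* `norm_le_of_gradPressure_le` — the same from plain bounds `‖∇p‖ ≤ P`, `‖f‖ ≤ F` at those maxima:
  `‖u(t, x)‖ ≤ A + (P + F)(t − T₁)`.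
* `Stage.continuation_norm_le_of_gradPressure_le` — for a finite-energy classical continuation of a
  registered level-`k` stage (`k ≥ 1`, quiet schedule): `‖u(t, ·)‖ ≤ c₂ Y_k + P (t − τ_k)` on `[τ_k, T']`
  if `‖∇p‖ ≤ P` at running maxima above `c₂ Y_k` — so an overshoot of `c₂ Y_{k+1}` needs TIME at least
  `c₂ (Y_{k+1} − Y_k)/P` after `τ_k` (a pressure-gradient form of the Kato window of p429305).
* `aprioriCeilingAt_of_gradPressure_lt` (`k ≥ 1`) / `aprioriCeiling_of_gradPressure_lt` — the upper
  stubs from the PRESSURE-GRADIENT CEILING `‖∇p(t, x)‖ < c₂ (Y_{k+1} − Y_k)/(τ_{k+1} − τ_k)` at running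
  global speed maxima in the band `(c₂ Y_k, c₂ Y_{k+1}]`; at `k = 1` the numeral `1.021·10⁸` suffices
  (`aprioriCeilingAt_one_of_gradPressure_le_num`).

References: D. Gilbarg, N. Trudinger, *Elliptic PDE of second order*, §3.1 [cite: GilbargTrudinger2001, §3.1];
S. Palasek, arXiv:2605.13827 §4 [cite: Palasek2026ElementaryModel, §4].
-/

noncomputable section

namespace Summit.NavierStokesRegularity.FluidComputer.PalasekTowerClayBridge

open Set MeasureTheory Filter Topology Function Real
open scoped ENNReal ContDiff NNReal InnerProductSpace RealInnerProductSpace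
open Laplacian
open Literature.Analysis.FluidPDE

/-! ## §1 The speed limit for any finite-energy classical Clay flow -/

/-- **THE PRESSURE SPEED LIMIT.** Let `(u, p)` be a finite-energy classical solution on `[0, T]` with
Schwartz datum and Clay force (`ν > 0`), `‖u‖ ≤ A` on `[0, T₁] × ℝ³` (`0 ≤ T₁ ≤ T`), and suppose that
at every `t ∈ (T₁, T]` and every global argmax `x` of `‖u(t, ·)‖` with `A < ‖u(t, x)‖` exceeding all
earlier speeds, the velocity-projected push obeys `⟪u, f⟫ − ⟪u, ∇p⟫ ≤ K ‖u‖` (`K ≥ 0`). Then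
`‖u(t, x)‖ ≤ A + K (t − T₁)` for all `t ∈ [T₁, T]` and all `x`. (If the speed `A + K(t − T₁)` were
exceeded at `t`, a line of slope `Λ ∈ (K, mean rate)` would be crossed first at a running maximum where
`Λ‖u‖ ≤ ⟪u, f⟫ − ⟪u, ∇p⟫ − ν|Du|²_F ≤ K‖u‖`, `‖u‖ > 0`.) [cite: GilbargTrudinger2001, §3.1] -/
theorem norm_le_of_pushRate {ν T : ℝ} (hν : 0 < ν) (hT : 0 < T)
    {f u : ℝ → EuclideanSpace ℝ (Fin 3) → EuclideanSpace ℝ (Fin 3)}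
    {p : ℝ → EuclideanSpace ℝ (Fin 3) → ℝ}
    (h : IsClassicalNSSolutionOn (Icc 0 T) ν f u p) (h₀ : HasRapidSpatialDecay (u 0))
    (hfs : IsSmoothOnHalfSpace f) (hfd : HasRapidSpaceTimeDecay f)
    (hE : ∃ C : ℝ≥0∞, C < ⊤ ∧ ∀ t ∈ Icc 0 T, ∫⁻ x, ‖u t x‖ₑ ^ 2 ≤ C)
    {A K T₁ : ℝ} (hT₁ : T₁ ∈ Icc 0 T) (hK : 0 ≤ K)
    (hA : ∀ t ∈ Icc 0 T₁, ∀ x, ‖u t x‖ ≤ A)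
    (hpush : ∀ t ∈ Ioc T₁ T, ∀ x : EuclideanSpace ℝ (Fin 3),
      (∀ y, ‖u t y‖ ≤ ‖u t x‖) → A < ‖u t x‖ → (∀ t' ∈ Ico 0 t, ∀ y, ‖u t' y‖ < ‖u t x‖) →
      ⟪u t x, f t x⟫ - ⟪u t x, gradient (p t) x⟫ ≤ K * ‖u t x‖) :
    ∀ t ∈ Icc T₁ T, ∀ x, ‖u t x‖ ≤ A + K * (t - T₁) := by
  intro t ht x
  by_contra hgt
  have hgt' : A + K * (t - T₁) < ‖u t x‖ := lt_of_not_ge hgt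
  have hA0 : 0 ≤ A := (norm_nonneg _).trans (hA 0 ⟨le_rfl, hT₁.1⟩ 0)
  -- the overshoot happens strictly after `T₁`
  have hT₁t : T₁ < t := by
    rcases ht.1.eq_or_lt with h' | h'
    · exfalso
      rw [← h', sub_self, mul_zero, add_zero] at hgt'
      exact absurd (hA T₁ ⟨hT₁.1, le_rfl⟩ x) (not_le.2 hgt')
    · exact h'
  have hw : 0 < t - T₁ := sub_pos.2 hT₁t
  set B : ℝ := ‖u t x‖ with hBdef
  -- a slope strictly between `K` and the mean rate `(B − A)/(t − T₁)`
  obtain ⟨Λ, hKΛ, hΛm⟩ := exists_between ((lt_div_iff₀ hw).2 (by linarith) : K < (B - A) / (t - T₁))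
  have hΛ0 : 0 ≤ Λ := hK.trans hKΛ.le
  have hΛw : Λ * (t - T₁) < B - A := (lt_div_iff₀ hw).1 hΛm
  set L₁ : ℝ := B - Λ * (t - T₁) with hL₁def
  have hL₁A : A < L₁ := by simp only [hL₁def]; linarith
  have hL₁ : 0 < L₁ := lt_of_le_of_lt hA0 hL₁A
  have hL₂ : 0 < L₁ + Λ * (t - T₁) := by
    have : L₁ + Λ * (t - T₁) = B := by simp only [hL₁def]; ring
    rw [this]; exact lt_of_le_of_lt (by positivity) hgt'
  have hbefore : ∀ s ∈ Icc 0 T₁, ∀ y, ‖u s y‖ < L₁ := fun s hs y => lt_of_le_of_lt (hA s hs y) hL₁A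
  have hreach : ∃ y, L₁ + Λ * (t - T₁) ≤ ‖u t y‖ := ⟨x, by simp only [hL₁def, hBdef]; linarith⟩
  obtain ⟨t₀, ht₀, x₀, hval, hmax, hstrict, -, hineq⟩ :=
    exists_lineCrossing_of_clayContinuation hν hT h h₀ hfs hfd hE hT₁.1 ht.1 ht.2 hL₁ hL₂ hbefore hreach
  have ht₀' : t₀ ∈ Ioc T₁ T := ⟨ht₀.1, ht₀.2.trans ht.2⟩
  have hlow : A < ‖u t₀ x₀‖ := by
    rw [hval]
    have : 0 ≤ Λ * (t₀ - T₁) := mul_nonneg hΛ0 (by linarith [ht₀.1])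
    linarith
  have hpos : 0 < ‖u t₀ x₀‖ := lt_of_le_of_lt hA0 hlow
  have hstrict' : ∀ t' ∈ Ico 0 t₀, ∀ y, ‖u t' y‖ < ‖u t₀ x₀‖ := by
    intro t' ht' y
    refine lt_of_lt_of_le (hstrict t' ht' y) ?_
    rw [hval]
    have hm : Λ * max (t' - T₁) 0 ≤ Λ * (t₀ - T₁) :=
      mul_le_mul_of_nonneg_left (max_le (by linarith [ht'.2]) (by linarith [ht₀.1])) hΛ0
    linarith
  have hp := hpush t₀ ht₀' x₀ hmax hlow hstrict'
  have hF : 0 ≤ ν * frobeniusNormSq (fderiv ℝ (u t₀) x₀) := mul_nonneg hν.le (frobeniusNormSq_nonneg _)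
  have h1 : Λ * ‖u t₀ x₀‖ ≤ K * ‖u t₀ x₀‖ := by linarith
  have h2 : (Λ - K) * ‖u t₀ x₀‖ ≤ 0 := by nlinarith
  have h3 : 0 < (Λ - K) * ‖u t₀ x₀‖ := mul_pos (sub_pos.2 hKΛ) hpos
  linarith

/-- **The speed limit from plain bounds**: if `‖∇p(t, x)‖ ≤ P` and `‖f(t, x)‖ ≤ F` (`P, F ≥ 0`) at every
running global speed maximum above `A` after `T₁`, then `‖u(t, x)‖ ≤ A + (P + F)(t − T₁)` on
`[T₁, T] × ℝ³` (Cauchy–Schwarz in `norm_le_of_pushRate`). [cite: GilbargTrudinger2001, §3.1] -/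
theorem norm_le_of_gradPressure_le {ν T : ℝ} (hν : 0 < ν) (hT : 0 < T)
    {f u : ℝ → EuclideanSpace ℝ (Fin 3) → EuclideanSpace ℝ (Fin 3)}
    {p : ℝ → EuclideanSpace ℝ (Fin 3) → ℝ}
    (h : IsClassicalNSSolutionOn (Icc 0 T) ν f u p) (h₀ : HasRapidSpatialDecay (u 0))
    (hfs : IsSmoothOnHalfSpace f) (hfd : HasRapidSpaceTimeDecay f)
    (hE : ∃ C : ℝ≥0∞, C < ⊤ ∧ ∀ t ∈ Icc 0 T, ∫⁻ x, ‖u t x‖ₑ ^ 2 ≤ C)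
    {A P F T₁ : ℝ} (hT₁ : T₁ ∈ Icc 0 T) (hP : 0 ≤ P) (hF : 0 ≤ F)
    (hA : ∀ t ∈ Icc 0 T₁, ∀ x, ‖u t x‖ ≤ A)
    (hbd : ∀ t ∈ Ioc T₁ T, ∀ x : EuclideanSpace ℝ (Fin 3),
      (∀ y, ‖u t y‖ ≤ ‖u t x‖) → A < ‖u t x‖ → (∀ t' ∈ Ico 0 t, ∀ y, ‖u t' y‖ < ‖u t x‖) →
      ‖gradient (p t) x‖ ≤ P ∧ ‖f t x‖ ≤ F) :
    ∀ t ∈ Icc T₁ T, ∀ x, ‖u t x‖ ≤ A + (P + F) * (t - T₁) := by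
  refine norm_le_of_pushRate hν hT h h₀ hfs hfd hE hT₁ (add_nonneg hP hF) hA ?_
  intro t ht x hmax hlow hstrict
  obtain ⟨hp, hf⟩ := hbd t ht x hmax hlow hstrict
  have h1 : ⟪u t x, f t x⟫ ≤ ‖u t x‖ * ‖f t x‖ := real_inner_le_norm _ _
  have h2 : - ⟪u t x, gradient (p t) x⟫ ≤ ‖u t x‖ * ‖gradient (p t) x‖ := by
    have := abs_real_inner_le_norm (u t x) (gradient (p t) x)
    have := neg_abs_le ⟪u t x, gradient (p t) x⟫
    linarith
  have h0 : 0 ≤ ‖u t x‖ := norm_nonneg _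
  have h3 : ‖u t x‖ * ‖f t x‖ ≤ ‖u t x‖ * F := mul_le_mul_of_nonneg_left hf h0
  have h4 : ‖u t x‖ * ‖gradient (p t) x‖ ≤ ‖u t x‖ * P := mul_le_mul_of_nonneg_left hp h0
  linarith

/-! ## §2 Continuations of registered stages: time to overshoot, and the pressure-gradient ceiling -/

namespace Stage

variable {ν : ℝ} {R : TowerRates} {S : Schedule R} {m : Margins R} {k : ℕ}

/-- **TIME TO OVERSHOOT.** Let `(u, p)` be a finite-energy classical continuation of a registered stage at
level `k ≥ 1` of a quiet schedule (`ν > 0`) on `[0, T']`, `T' ≥ τ_k`, and suppose `‖∇p(t, x)‖ ≤ P`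
(`P ≥ 0`) at every running global speed maximum above `c₂ Y_k` after `τ_k`. Then
`‖u(t, x)‖ ≤ c₂ Y_k + P (t − τ_k)` on `[τ_k, T'] × ℝ³` (the force is silent): the next ceiling
`c₂ Y_{k+1}` cannot be exceeded before `τ_k + c₂ (Y_{k+1} − Y_k)/P` — a pressure-gradient form of the
Kato window (p429305). [cite: Palasek2026ElementaryModel, §4] -/
theorem continuation_norm_le_of_gradPressure_le (hν : 0 < ν) (hQ : S.Quiet) (hk : 1 ≤ k)
    (s : Stage ν R S m k) {T' : ℝ} (hT' : S.τ k ≤ T')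
    {u : ℝ → EuclideanSpace ℝ (Fin 3) → EuclideanSpace ℝ (Fin 3)}
    {p : ℝ → EuclideanSpace ℝ (Fin 3) → ℝ}
    (hcl : IsClassicalNSSolutionOn (Icc 0 T') ν S.f u p)
    (hagree : ∀ t ∈ Icc 0 (S.τ k), u t = s.u t)
    (henergy : ∃ C : ℝ≥0∞, C < ⊤ ∧ ∀ t ∈ Icc 0 T', ∫⁻ x, ‖u t x‖ₑ ^ 2 ≤ C)
    {P : ℝ} (hP : 0 ≤ P)
    (hbd : ∀ t ∈ Ioc (S.τ k) T', ∀ x : EuclideanSpace ℝ (Fin 3),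
      (∀ y, ‖u t y‖ ≤ ‖u t x‖) → S.c₂ * R.Y k < ‖u t x‖ →
      (∀ t' ∈ Ico 0 t, ∀ y, ‖u t' y‖ < ‖u t x‖) → ‖gradient (p t) x‖ ≤ P) :
    ∀ t ∈ Icc (S.τ k) T', ∀ x, ‖u t x‖ ≤ S.c₂ * R.Y k + P * (t - S.τ k) := by
  have hT'0 : 0 < T' := (S.τ_pos k).trans_le hT'
  have h₀ : HasRapidSpatialDecay (u 0) := by
    rw [hagree 0 ⟨le_rfl, (S.τ_pos k).le⟩]
    exact s.hasRapidSpatialDecay_zero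
  have hA : ∀ t ∈ Icc 0 (S.τ k), ∀ x, ‖u t x‖ ≤ S.c₂ * R.Y k := fun t ht x => by
    rw [hagree t ht]; exact s.ceiling k le_rfl t ht x
  have h := norm_le_of_gradPressure_le hν hT'0 hcl h₀ S.force_smooth S.force_decay henergy
    ⟨(S.τ_pos k).le, hT'⟩ hP le_rfl hA (F := 0) ?_
  · simpa only [add_zero] using h
  · intro t ht x hmax hlow hstrict
    refine ⟨hbd t ht x hmax hlow hstrict, ?_⟩
    have h1 : S.τ 1 ≤ t := (S.τ_mono hk).trans ht.1.le
    rw [hQ.apply h1 x, norm_zero]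

end Stage

/-- **`AprioriCeilingAt k` FROM A PRESSURE-GRADIENT CEILING at running speed maxima** (`k ≥ 1`): if for
every pinned rigid quiet wide schedule, every registered level-`k` stage, every `T' ∈ [τ_k, τ_{k+1}]` and
every finite-energy classical continuation (unit viscosity), at every `t ∈ (τ_k, T']` and every global
argmax `x` with speed in the band `(c₂ Y_k, c₂ Y_{k+1}]` exceeding all earlier speeds,
`‖∇p(t, x)‖ < c₂ (Y_{k+1} − Y_k)/(τ_{k+1} − τ_k)`, then the a-priori ceiling holds
(`aprioriCeilingAt_of_pressureRate` + Cauchy–Schwarz). [cite: Palasek2026ElementaryModel, §4] -/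
theorem aprioriCeilingAt_of_gradPressure_lt {k : ℕ} (hk : 1 ≤ k)
    (h : ∀ S : Schedule TowerRates.wide, S.Pins 8 (6 / 5) → S.Rigid → S.Quiet →
      ∀ s : Stage 1 TowerRates.wide S (Margins.routeG TowerRates.wide) k,
      ∀ T' ∈ Icc (S.τ k) (S.τ (k + 1)),
      ∀ (u : ℝ → EuclideanSpace ℝ (Fin 3) → EuclideanSpace ℝ (Fin 3))
        (p : ℝ → EuclideanSpace ℝ (Fin 3) → ℝ),
        IsClassicalNSSolutionOn (Icc 0 T') 1 S.f u p →
        (∀ t ∈ Icc 0 (S.τ k), u t = s.u t ∧ p t = s.p t) →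
        (∃ C : ℝ≥0∞, C < ⊤ ∧ ∀ t ∈ Icc 0 T', ∫⁻ x, ‖u t x‖ₑ ^ 2 ≤ C) →
        ∀ t ∈ Ioc (S.τ k) T', ∀ x : EuclideanSpace ℝ (Fin 3),
          (∀ y, ‖u t y‖ ≤ ‖u t x‖) →
          S.c₂ * TowerRates.wide.Y k < ‖u t x‖ → ‖u t x‖ ≤ S.c₂ * TowerRates.wide.Y (k + 1) →
          (∀ t' ∈ Ico 0 t, ∀ y, ‖u t' y‖ < ‖u t x‖) →
          ‖gradient (p t) x‖ <
            (S.c₂ * TowerRates.wide.Y (k + 1) - S.c₂ * TowerRates.wide.Y k) / (S.τ (k + 1) - S.τ k)) :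
    AprioriCeilingAt k := by
  refine aprioriCeilingAt_of_pressureRate hk ?_
  intro S hP hR hQ s T' hT' u p hcl hagree henergy t ht x hmax hlow hupp hstrict
  have hg := h S hP hR hQ s T' hT' u p hcl hagree henergy t ht x hmax hlow hupp hstrict
  have hpos : 0 < ‖u t x‖ :=
    lt_trans (mul_pos s.c₂_pos (Real.rpow_pos_of_pos (TowerRates.wide.N_pos k) _)) hlow
  have hCS : - ⟪u t x, gradient (p t) x⟫ ≤ ‖u t x‖ * ‖gradient (p t) x‖ := by
    have := abs_real_inner_le_norm (u t x) (gradient (p t) x)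
    have := neg_abs_le ⟪u t x, gradient (p t) x⟫
    linarith
  have hF : 0 ≤ frobeniusNormSq (fderiv ℝ (u t) x) := frobeniusNormSq_nonneg _
  have h1 : ‖u t x‖ * ‖gradient (p t) x‖ <
      ‖u t x‖ * ((S.c₂ * TowerRates.wide.Y (k + 1) - S.c₂ * TowerRates.wide.Y k) /
        (S.τ (k + 1) - S.τ k)) := mul_lt_mul_of_pos_left hg hpos
  linarith

/-- **`AprioriCeiling` (all `k ≥ 2`) FROM THE PRESSURE-GRADIENT CEILING at every level.**
[cite: Palasek2026ElementaryModel, §4] -/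
theorem aprioriCeiling_of_gradPressure_lt
    (h : ∀ S : Schedule TowerRates.wide, S.Pins 8 (6 / 5) → S.Rigid → S.Quiet → ∀ k : ℕ, 2 ≤ k →
      ∀ s : Stage 1 TowerRates.wide S (Margins.routeG TowerRates.wide) k,
      ∀ T' ∈ Icc (S.τ k) (S.τ (k + 1)),
      ∀ (u : ℝ → EuclideanSpace ℝ (Fin 3) → EuclideanSpace ℝ (Fin 3))
        (p : ℝ → EuclideanSpace ℝ (Fin 3) → ℝ),
        IsClassicalNSSolutionOn (Icc 0 T') 1 S.f u p →
        (∀ t ∈ Icc 0 (S.τ k), u t = s.u t ∧ p t = s.p t) →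
        (∃ C : ℝ≥0∞, C < ⊤ ∧ ∀ t ∈ Icc 0 T', ∫⁻ x, ‖u t x‖ₑ ^ 2 ≤ C) →
        ∀ t ∈ Ioc (S.τ k) T', ∀ x : EuclideanSpace ℝ (Fin 3),
          (∀ y, ‖u t y‖ ≤ ‖u t x‖) →
          S.c₂ * TowerRates.wide.Y k < ‖u t x‖ → ‖u t x‖ ≤ S.c₂ * TowerRates.wide.Y (k + 1) →
          (∀ t' ∈ Ico 0 t, ∀ y, ‖u t' y‖ < ‖u t x‖) →
          ‖gradient (p t) x‖ <
            (S.c₂ * TowerRates.wide.Y (k + 1) - S.c₂ * TowerRates.wide.Y k) / (S.τ (k + 1) - S.τ k)) :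
    AprioriCeiling := by
  refine aprioriCeiling_of_pressureRate ?_
  intro S hP hR hQ k hk s T' hT' u p hcl hagree henergy t ht x hmax hlow hupp hstrict
  have hg := h S hP hR hQ k hk s T' hT' u p hcl hagree henergy t ht x hmax hlow hupp hstrict
  have hpos : 0 < ‖u t x‖ :=
    lt_trans (mul_pos s.c₂_pos (Real.rpow_pos_of_pos (TowerRates.wide.N_pos k) _)) hlow
  have hCS : - ⟪u t x, gradient (p t) x⟫ ≤ ‖u t x‖ * ‖gradient (p t) x‖ := by
    have := abs_real_inner_le_norm (u t x) (gradient (p t) x)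
    have := neg_abs_le ⟪u t x, gradient (p t) x⟫
    linarith
  have hF : 0 ≤ frobeniusNormSq (fderiv ℝ (u t) x) := frobeniusNormSq_nonneg _
  have h1 : ‖u t x‖ * ‖gradient (p t) x‖ <
      ‖u t x‖ * ((S.c₂ * TowerRates.wide.Y (k + 1) - S.c₂ * TowerRates.wide.Y k) /
        (S.τ (k + 1) - S.τ k)) := mul_lt_mul_of_pos_left hg hpos
  linarith

/-- **`AprioriCeilingAt 1` from the NUMERICAL pressure-gradient ceiling `‖∇p‖ ≤ 1.021·10⁸`** (item 19249's
upper stub, unit viscosity): if at every running global speed maximum in the band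
`((5/3) Y₁, (5/3) Y₂]` of every finite-energy classical continuation of every registered level-1 stage
of a pinned rigid quiet wide schedule, exceeding all earlier speeds, `‖∇p(t, x)‖ ≤ 1.021·10⁸`, then
`AprioriCeilingAt 1` (`Schedule.Rigid.overshootRate_one_bounds`: the overshoot rate exceeds `1.021·10⁸`).
[cite: Palasek2026ElementaryModel, §4] -/
theorem aprioriCeilingAt_one_of_gradPressure_le_num
    (h : ∀ S : Schedule TowerRates.wide, S.Pins 8 (6 / 5) → S.Rigid → S.Quiet →
      ∀ s : Stage 1 TowerRates.wide S (Margins.routeG TowerRates.wide) 1,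
      ∀ T' ∈ Icc (S.τ 1) (S.τ 2),
      ∀ (u : ℝ → EuclideanSpace ℝ (Fin 3) → EuclideanSpace ℝ (Fin 3))
        (p : ℝ → EuclideanSpace ℝ (Fin 3) → ℝ),
        IsClassicalNSSolutionOn (Icc 0 T') 1 S.f u p →
        (∀ t ∈ Icc 0 (S.τ 1), u t = s.u t ∧ p t = s.p t) →
        (∃ C : ℝ≥0∞, C < ⊤ ∧ ∀ t ∈ Icc 0 T', ∫⁻ x, ‖u t x‖ₑ ^ 2 ≤ C) →
        ∀ t ∈ Ioc (S.τ 1) T', ∀ x : EuclideanSpace ℝ (Fin 3),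
          (∀ y, ‖u t y‖ ≤ ‖u t x‖) →
          S.c₂ * TowerRates.wide.Y 1 < ‖u t x‖ → ‖u t x‖ ≤ S.c₂ * TowerRates.wide.Y 2 →
          (∀ t' ∈ Ico 0 t, ∀ y, ‖u t' y‖ < ‖u t x‖) →
          ‖gradient (p t) x‖ ≤ 102100000) :
    AprioriCeilingAt 1 := by
  refine aprioriCeilingAt_of_gradPressure_lt le_rfl ?_
  intro S hP hR hQ s T' hT' u p hcl hagree henergy t ht x hmax hlow hupp hstrict
  have hg := h S hP hR hQ s T' hT' u p hcl hagree henergy t ht x hmax hlow hupp hstrict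
  obtain ⟨hrate, -⟩ := hR.overshootRate_one_bounds
  rw [show (1 : ℕ) + 1 = 2 from rfl]
  exact lt_of_le_of_lt hg hrate

end Summit.NavierStokesRegularity.FluidComputer.PalasekTowerClayBridge

end
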